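import Summits.ValiantsHypothesis.ValiantsHypothesis.Theorems.DepthWindowBoundedLetters

/-!
# Route `DepthWindow` — bounded alphabets in LOGARITHMIC extra depth (all pools side by side)

Cone-free theorem (decomp-valiant lens 4, g15; critic-675 NEXT (c)) supporting the crux item `HomImmHardTwoOne`
(stmt-ValiantsHypothesis-30635).  `DepthWindowBoundedLetters` peels one value per level (`+n` levels for `n + 1`
values).  Here all peels are performed FIRST, as a partition of the letters into POOLS (`exists_pooling`: each
pool two-valued or one-signed, every pool sum `≤ h` in absolute value, at most `n + 1` pools), the pools are
built SIDE BY SIDE to a common depth by the two-letter theorem, and the quotient word of pool sums — at most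
`n + 1` letters bounded by `h` with total `Σ w` — is finished by the prefix-bounded interval tree
(`lowBiasTree_clog_of_bounded`, depth `⌈log₂ (n+1)⌉`, bias `4h`), grafted on top (`lowBiasTree_graft`):

* `lowBiasTree_of_card_image_le_clog` — at most `n + 1` values, `|wᵢ| ≤ h`, `|Σ w| ≤ h` ⇒ a tree of node bias
  `≤ 6h` at every depth `Δ ≥ 2·⌊log₂⌊log₂ h⌋⌋ + 8 + ⌈log₂(n+1)⌉` (or `≥ 2·⌊log₂⌊log₂ d⌋⌋ + 9 + ⌈log₂(n+1)⌉`);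
* `not_boundedLetters_treeBiasGrowthAt_clog` — the door corollary with instance `c := 9 + ⌈log₂(k+1)⌉`: a
  family serving the instance `(c, 6)` of `TreeBiasGrowthAt a`, `a ≥ 2`, needs MORE THAN `2^(c-9)` letter values.

This is the natural ceiling of pool-and-merge: pool sums are only controlled to `< h` each (rounding
granularity = a letter value), so `k` pools cost `log k` merge levels; doing better for alphabets growing with
`d` requires cancellation ACROSS values at the bottom levels (NODE-v15 §5).

References: [LimayeSrinivasanTavenas2022] CCC 2022 (LIPIcs 234:32) Def. 2, Question 1; full version ECCC
TR22-090 Def. 15, Prop. 16–17; [BhargavDuttaSaxena2024] ACM ToCT 16(4):23 Thm. 1.4.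
-/

-- layout Summits/ValiantsHypothesis/ValiantsHypothesis forces the duplicated namespace component
set_option linter.dupNamespace false

namespace Summit.ValiantsHypothesis.ValiantsHypothesis.Theorems.DepthWindow.TreeBias

open Finset Literature.Computability.AlgebraicComplexity

/-- Node-bias budgets are monotone. [folklore] -/
theorem LowBiasTree.bias_mono {d : ℕ} {w : Fin d → ℤ} {Δ : ℕ} {β β' : ℤ} (hT : LowBiasTree w Δ β)
    (hle : β ≤ β') : LowBiasTree w Δ β' := by
  obtain ⟨T, hroot, hnb⟩ := hT
  exact ⟨T, hroot, fun u hu1 hu i => (hnb u hu1 hu i).trans hle⟩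

/-! ### Cutting one pool out of a set of letters -/

/-- One-sided pool: `a < 0 < b` values on `U`, `#a·|a| ≤ #b·b`; the pool is all `a`-letters of `U` and `M'`
`b`-letters, rounded towards the total (`peel_arith`). [folklore] -/
theorem exists_pool_core {d : ℕ} (w : Fin d → ℤ) (h : ℕ) (U : Finset (Fin d)) (hsum : |∑ j ∈ U, w j| ≤ h)
    {a b : ℤ} (ha : a < 0) (hb : 0 < b) (hbh : b ≤ h) (hma : ∃ i ∈ U, w i = a)
    (hcond : ((U.filter fun j => w j = a).card : ℤ) * (-a) ≤ ((U.filter fun j => w j = b).card : ℤ) * b) :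
    ∃ P ⊆ U, P.Nonempty ∧ (∀ j ∈ P, w j = a ∨ w j = b) ∧ |∑ j ∈ P, w j| ≤ h ∧ |∑ j ∈ U \ P, w j| ≤ h ∧
      ((U \ P).image w).card < (U.image w).card := by
  obtain ⟨a', ha'⟩ : ∃ a' : ℕ, (a' : ℤ) = -a := ⟨(-a).toNat, Int.toNat_of_nonneg (by linarith)⟩
  obtain ⟨b', hb'⟩ : ∃ b' : ℕ, (b' : ℤ) = b := ⟨b.toNat, Int.toNat_of_nonneg hb.le⟩
  have hb'1 : 1 ≤ b' := by omega
  have hb'h : b' ≤ h := by have : (b' : ℤ) ≤ h := hb' ▸ hbh; exact_mod_cast this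
  have hQ : (U.filter fun j => w j = a).card * a' ≤ (U.filter fun j => w j = b).card * b' := by
    have : ((U.filter fun j => w j = a).card : ℤ) * (a' : ℤ) ≤
        ((U.filter fun j => w j = b).card : ℤ) * (b' : ℤ) := by rw [ha', hb']; exact hcond
    exact_mod_cast this
  obtain ⟨M', hM'le, hI, hSI⟩ :=
    peel_arith ((U.filter fun j => w j = a).card * a') b' (U.filter fun j => w j = b).card h (∑ j ∈ U, w j)
      hb'1 hb'h hQ hsum
  obtain ⟨B', hB'sub, hB'card⟩ := exists_subset_card_eq hM'le
  have hmemA : ∀ {j}, j ∈ (U.filter fun j => w j = a) ↔ j ∈ U ∧ w j = a := by simp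
  have hmemB' : ∀ {j}, j ∈ B' → j ∈ U ∧ w j = b := fun hj => by simpa using hB'sub hj
  have hdisj : Disjoint (U.filter fun j => w j = a) B' := by
    rw [disjoint_left]; intro j hjA hjB
    have := (hmemA.1 hjA).2.symm.trans (hmemB' hjB).2; linarith
  have hPU : (U.filter fun j => w j = a) ∪ B' ⊆ U := union_subset (filter_subset _ _) fun j hj => (hmemB' hj).1
  have hP : ∑ j ∈ (U.filter fun j => w j = a) ∪ B', w j =
      (M' : ℤ) * b' - ((U.filter fun j => w j = a).card * a' : ℕ) := by
    rw [sum_union hdisj, sum_congr rfl fun j hj => (hmemA.1 hj).2, sum_congr rfl fun j hj => (hmemB' hj).2,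
      sum_const, sum_const, hB'card, nsmul_eq_mul, nsmul_eq_mul]
    push_cast
    rw [ha', hb']
    ring
  obtain ⟨i₀, hi₀U, hi₀⟩ := hma
  refine ⟨(U.filter fun j => w j = a) ∪ B', hPU, ⟨i₀, mem_union_left _ (hmemA.2 ⟨hi₀U, hi₀⟩)⟩,
    fun j hj => ?_, by rw [hP]; exact hI, by rw [sum_sdiff_eq_sub hPU, hP]; exact hSI, ?_⟩
  · rcases mem_union.1 hj with hj | hj
    · exact Or.inl (hmemA.1 hj).2
    · exact Or.inr (hmemB' hj).2
  · have hsub : (U \ ((U.filter fun j => w j = a) ∪ B')).image w ⊆ (U.image w).erase a := by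
      intro x hx
      obtain ⟨j, hj, rfl⟩ := mem_image.1 hx
      obtain ⟨hjU, hjP⟩ := mem_sdiff.1 hj
      refine mem_erase.2 ⟨fun hxa => hjP (mem_union_left _ (hmemA.2 ⟨hjU, hxa⟩)), mem_image_of_mem _ hjU⟩
    exact lt_of_le_of_lt (card_le_card hsub) (card_erase_lt_of_mem (mem_image.2 ⟨i₀, hi₀U, hi₀⟩))

/-- **One pool.**  If `a < 0 < b` are values of `w` on `U` (`|a|, b ≤ h`) and `|Σ_U w| ≤ h`, some nonempty
`P ⊆ U` carries only the values `a, b`, has `|Σ_P w| ≤ h`, leaves `|Σ_{U \ P} w| ≤ h`, and removes a value.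
[folklore] -/
theorem exists_pool {d : ℕ} (w : Fin d → ℤ) (h : ℕ) (U : Finset (Fin d)) (hsum : |∑ j ∈ U, w j| ≤ h)
    {a b : ℤ} (ha : a < 0) (hb : 0 < b) (hah : -a ≤ h) (hbh : b ≤ h) (hma : ∃ i ∈ U, w i = a)
    (hmb : ∃ i ∈ U, w i = b) :
    ∃ P ⊆ U, P.Nonempty ∧ (∀ j ∈ P, w j = a ∨ w j = b) ∧ |∑ j ∈ P, w j| ≤ h ∧ |∑ j ∈ U \ P, w j| ≤ h ∧
      ((U \ P).image w).card < (U.image w).card := by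
  rcases le_or_gt (((U.filter fun j => w j = a).card : ℤ) * (-a)) (((U.filter fun j => w j = b).card : ℤ) * b)
    with hle | hlt
  · exact exists_pool_core w h U hsum ha hb hbh hma hle
  · -- flip all signs: now `b` is the scarce value
    have e1 : (U.filter fun j => -w j = -b) = U.filter fun j => w j = b := by ext j; simp [neg_inj]
    have e2 : (U.filter fun j => -w j = -a) = U.filter fun j => w j = a := by ext j; simp [neg_inj]
    obtain ⟨P, hPU, hPne, hval, hI, hSI, hcard⟩ := exists_pool_core (fun j => -w j) h U
      (by rw [sum_neg_distrib, abs_neg]; exact hsum) (a := -b) (b := -a) (by linarith) (by linarith) hah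
      (by obtain ⟨i, hiU, hi⟩ := hmb; exact ⟨i, hiU, by rw [hi]⟩) (by rw [e1, e2, neg_neg]; exact hlt.le)
    refine ⟨P, hPU, hPne, fun j hj => (hval j hj).symm.imp neg_inj.1 neg_inj.1,
      by rwa [sum_neg_distrib, abs_neg] at hI, by rwa [sum_neg_distrib, abs_neg] at hSI, ?_⟩
    have himg : ∀ V : Finset (Fin d), (V.image fun j => -w j) = (V.image w).image Neg.neg := fun V => by
      rw [image_image]; rfl
    rwa [himg, himg, card_image_of_injective _ neg_injective, card_image_of_injective _ neg_injective] at hcard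

/-! ### The pooling -/

/-- **Pooling.**  A nonempty set `U` of letters with at most `n + 1` values, `|w| ≤ h` on `U`, `|Σ_U w| ≤ h`,
splits into `M ≤ n + 1` pools (the classes of `c` on `U`), each two-valued or one-signed and each with pool sum
`≤ h` in absolute value (iterate `exists_pool` until the rest is one-signed or two-valued). [folklore] -/
theorem exists_pooling (h : ℕ) : ∀ (n : ℕ) {d : ℕ} (w : Fin d → ℤ) (U : Finset (Fin d)), U.Nonempty →
    (U.image w).card ≤ n + 1 → (∀ j ∈ U, |w j| ≤ h) → |∑ j ∈ U, w j| ≤ h →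
    ∃ (M : ℕ) (c : Fin d → ℕ), M ≤ n + 1 ∧ (∀ j ∈ U, c j < M) ∧ (∀ m, m < M → ∃ j ∈ U, c j = m) ∧
      ∀ m, m < M →
        ((∃ x y : ℤ, ∀ j ∈ U, c j = m → (w j = x ∨ w j = y)) ∨
          (∀ j ∈ U, c j = m → 0 ≤ w j) ∨ (∀ j ∈ U, c j = m → w j ≤ 0)) ∧
        |∑ j ∈ U.filter (fun j => c j = m), w j| ≤ h := by
  -- one pool suffices when `U` is two-valued or one-signed
  have single : ∀ (n : ℕ) {d : ℕ} (w : Fin d → ℤ) (U : Finset (Fin d)), U.Nonempty → |∑ j ∈ U, w j| ≤ h →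
      ((∃ x y : ℤ, ∀ j ∈ U, w j = x ∨ w j = y) ∨ (∀ j ∈ U, 0 ≤ w j) ∨ (∀ j ∈ U, w j ≤ 0)) →
      ∃ (M : ℕ) (c : Fin d → ℕ), M ≤ n + 1 ∧ (∀ j ∈ U, c j < M) ∧ (∀ m, m < M → ∃ j ∈ U, c j = m) ∧
        ∀ m, m < M →
          ((∃ x y : ℤ, ∀ j ∈ U, c j = m → (w j = x ∨ w j = y)) ∨
            (∀ j ∈ U, c j = m → 0 ≤ w j) ∨ (∀ j ∈ U, c j = m → w j ≤ 0)) ∧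
          |∑ j ∈ U.filter (fun j => c j = m), w j| ≤ h := by
    intro n d w U hU hsum hcase
    refine ⟨1, fun _ => 0, by omega, fun _ _ => zero_lt_one, fun m hm => ?_, fun m hm => ⟨?_, ?_⟩⟩
    · obtain ⟨j, hj⟩ := hU; exact ⟨j, hj, show 0 = m by omega⟩
    · rcases hcase with ⟨x, y, hxy⟩ | hpos | hneg
      · exact Or.inl ⟨x, y, fun j hj _ => hxy j hj⟩
      · exact Or.inr (Or.inl fun j hj _ => hpos j hj)
      · exact Or.inr (Or.inr fun j hj _ => hneg j hj)
    · rwa [filter_true_of_mem fun j _ => show 0 = m by omega]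
  intro n
  induction n with
  | zero =>
    intro d w U hU hk hw hsum
    refine single 0 w U hU hsum (Or.inl ?_)
    obtain ⟨j₀, hj₀⟩ := hU
    exact ⟨w j₀, w j₀, fun j hj => Or.inl
      (card_le_one.1 hk _ (mem_image_of_mem _ hj) _ (mem_image_of_mem _ hj₀))⟩
  | succ n ih =>
    intro d w U hU hk hw hsum
    by_cases hcase : (∃ x y : ℤ, ∀ j ∈ U, w j = x ∨ w j = y) ∨ (∀ j ∈ U, 0 ≤ w j) ∨ (∀ j ∈ U, w j ≤ 0)
    · exact single (n + 1) w U hU hsum hcase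
    push Not at hcase
    obtain ⟨h2, ⟨i₀, hi₀U, hi₀⟩, ⟨j₀, hj₀U, hj₀⟩⟩ := hcase
    have hah : -w i₀ ≤ h := by have := hw i₀ hi₀U; rwa [abs_of_neg hi₀] at this
    have hbh : w j₀ ≤ h := by have := hw j₀ hj₀U; rwa [abs_of_pos hj₀] at this
    obtain ⟨P, hPU, hPne, hval, hI, hSI, hcard⟩ :=
      exists_pool w h U hsum hi₀ hj₀ hah hbh ⟨i₀, hi₀U, rfl⟩ ⟨j₀, hj₀U, rfl⟩
    -- the rest is nonempty: a third value exists
    have hU' : (U \ P).Nonempty := by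
      by_contra hemp
      rw [not_nonempty_iff_eq_empty, sdiff_eq_empty_iff_subset] at hemp
      obtain ⟨j, hjU, hja, hjb⟩ := h2 (w i₀) (w j₀)
      rcases hval j (hemp hjU) with e | e
      exacts [hja e, hjb e]
    obtain ⟨M', c', hM', hcM', hsurj', hpool'⟩ := ih w (U \ P) hU' (by omega)
      (fun j hj => hw j (sdiff_subset hj)) hSI
    classical
    refine ⟨M' + 1, fun j => if j ∈ P then M' else c' j, by omega, fun j hj => ?_, fun m hm => ?_,
      fun m hm => ?_⟩
    · dsimp only
      by_cases hjP : j ∈ P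
      · rw [if_pos hjP]; exact Nat.lt_succ_self _
      · rw [if_neg hjP]; exact (hcM' j (mem_sdiff.2 ⟨hj, hjP⟩)).trans (Nat.lt_succ_self _)
    · dsimp only
      rcases Nat.lt_succ_iff_lt_or_eq.1 hm with hm | hmM
      · obtain ⟨j, hj, hjm⟩ := hsurj' m hm
        obtain ⟨hjU, hjP⟩ := mem_sdiff.1 hj
        exact ⟨j, hjU, by rw [if_neg hjP]; exact hjm⟩
      · obtain ⟨j, hj⟩ := hPne
        exact ⟨j, hPU hj, by rw [if_pos hj, hmM]⟩
    dsimp only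
    -- which letters of `U` land in class `m`
    have hcls : ∀ j ∈ U, ((if j ∈ P then M' else c' j) = m) ↔
        (m = M' ∧ j ∈ P) ∨ (m < M' ∧ j ∈ U \ P ∧ c' j = m) := by
      intro j hj
      by_cases hjP : j ∈ P
      · rw [if_pos hjP]
        constructor
        · intro e; exact Or.inl ⟨e.symm, hjP⟩
        · rintro (⟨e, -⟩ | ⟨-, hj', -⟩)
          · exact e.symm
          · exact absurd hjP (mem_sdiff.1 hj').2
      · rw [if_neg hjP]
        have hj' : j ∈ U \ P := mem_sdiff.2 ⟨hj, hjP⟩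
        have hlt := hcM' j hj'
        constructor
        · intro e; exact Or.inr ⟨e ▸ hlt, hj', e⟩
        · rintro (⟨e, hjP'⟩ | ⟨-, -, e⟩)
          · exact absurd hjP' hjP
          · exact e
    rcases Nat.lt_succ_iff_lt_or_eq.1 hm with hm | hmM
    · -- an old pool
      have hne : m ≠ M' := Nat.ne_of_lt hm
      have hiff : ∀ j ∈ U, ((if j ∈ P then M' else c' j) = m) ↔ (j ∈ U \ P ∧ c' j = m) := fun j hj => by
        rw [hcls j hj]
        constructor
        · rintro (⟨e, -⟩ | ⟨-, hj', e⟩)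
          · exact absurd e hne
          · exact ⟨hj', e⟩
        · rintro ⟨hj', e⟩; exact Or.inr ⟨hm, hj', e⟩
      have hset : (U.filter fun j => (if j ∈ P then M' else c' j) = m) = (U \ P).filter fun j => c' j = m := by
        ext j
        simp only [mem_filter]
        constructor
        · rintro ⟨hj, e⟩; exact (hiff j hj).1 e
        · rintro ⟨hj', e⟩; exact ⟨sdiff_subset hj', (hiff j (sdiff_subset hj')).2 ⟨hj', e⟩⟩
      obtain ⟨hprop, hs⟩ := hpool' m hm
      refine ⟨?_, by rw [hset]; exact hs⟩
      rcases hprop with ⟨x, y, hxy⟩ | hpos | hneg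
      · exact Or.inl ⟨x, y, fun j hj e => by
          obtain ⟨hj', e'⟩ := (hiff j hj).1 e; exact hxy j hj' e'⟩
      · exact Or.inr (Or.inl fun j hj e => by obtain ⟨hj', e'⟩ := (hiff j hj).1 e; exact hpos j hj' e')
      · exact Or.inr (Or.inr fun j hj e => by obtain ⟨hj', e'⟩ := (hiff j hj).1 e; exact hneg j hj' e')
    · -- the new pool `P`
      have hiff : ∀ j ∈ U, ((if j ∈ P then M' else c' j) = m) ↔ j ∈ P := fun j hj => by
        rw [hcls j hj]
        constructor
        · rintro (⟨-, hjP⟩ | ⟨hlt, -, -⟩)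
          · exact hjP
          · exact absurd hlt (by rw [hmM]; exact lt_irrefl _)
        · intro hjP; exact Or.inl ⟨hmM, hjP⟩
      have hset : (U.filter fun j => (if j ∈ P then M' else c' j) = m) = P := by
        ext j
        simp only [mem_filter]
        constructor
        · rintro ⟨hj, e⟩; exact (hiff j hj).1 e
        · intro hjP; exact ⟨hPU hjP, (hiff j (hPU hjP)).2 hjP⟩
      exact ⟨Or.inl ⟨w i₀, w j₀, fun j hj e => hval j ((hiff j hj).1 e)⟩, by rw [hset]; exact hI⟩

/-! ### `ULB₂` on bounded alphabets, logarithmic extra depth -/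

/-- **`ULB₂` for at most `n + 1` values, all pools side by side.**  Node bias `≤ 6h` at every depth
`Δ ≥ 2·⌊log₂⌊log₂ h⌋⌋ + 8 + ⌈log₂(n+1)⌉`, and at every depth `Δ ≥ 2·⌊log₂⌊log₂ d⌋⌋ + 9 + ⌈log₂(n+1)⌉`.
[cite: LimayeSrinivasanTavenas2022, Question 1] -/
theorem lowBiasTree_of_card_image_le_clog (h n : ℕ) {d : ℕ} (w : Fin d → ℤ)
    (hk : (univ.image w).card ≤ n + 1) (hw : ∀ i, |w i| ≤ h) (hsum : |∑ i, w i| ≤ h) {Δ : ℕ}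
    (hΔ : 2 * Nat.log 2 (Nat.log 2 h) + 8 + Nat.clog 2 (n + 1) ≤ Δ ∨
      2 * Nat.log 2 (Nat.log 2 d) + 9 + Nat.clog 2 (n + 1) ≤ Δ) :
    LowBiasTree w Δ ((6 * h : ℕ) : ℤ) := by
  rcases Nat.eq_zero_or_pos d with rfl | hd
  · exact lowBiasTree_of_sum_abs_le (by simp) (by omega)
  obtain ⟨M, c, hM, hcM, hsurj, hpool⟩ := exists_pooling h n w univ ⟨⟨0, hd⟩, mem_univ _⟩ hk
    (fun j _ => hw j) (by simpa using hsum)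
  let cF : Fin d → Fin M := fun j => ⟨c j, hcM j (mem_univ j)⟩
  have hcF : Function.Surjective cF := fun m => by
    obtain ⟨j, -, hj⟩ := hsurj m.val m.isLt
    exact ⟨j, Fin.ext hj⟩
  obtain ⟨R, rfl⟩ : ∃ R, Δ = R + Nat.clog 2 (n + 1) := ⟨Δ - Nat.clog 2 (n + 1), by omega⟩
  have hR : 2 * Nat.log 2 (Nat.log 2 h) + 8 ≤ R ∨ 2 * Nat.log 2 (Nat.log 2 d) + 9 ≤ R := by omega
  have hR1 : 1 ≤ R := by omega
  have h6 : (h : ℤ) ≤ ((6 * h : ℕ) : ℤ) := by push_cast; linarith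
  -- fibre bookkeeping
  have hfibval : ∀ (m : Fin M) (i : Fin (fib cF m).card), c (emb cF m i) = m.val := fun m i =>
    congrArg Fin.val (c_emb cF m i)
  have hfilter : ∀ m : Fin M, (univ.filter fun j => cF j = m) = univ.filter fun j => c j = m.val := fun m => by
    ext j; simp [cF, Fin.ext_iff]
  have hqm : ∀ m : Fin M, |quotWord w cF m| ≤ h := fun m => by
    unfold quotWord; rw [hfilter]; exact (hpool m.val m.isLt).2
  have hcard : ∀ m, (fib cF m).card ≤ d := fun m => (card_le_univ _).trans (by simp)
  -- the pools, side by side, to depth `R`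
  have hfib : ∀ m, LowBiasTree (w ∘ emb cF m) R ((6 * h : ℕ) : ℤ) := by
    intro m
    have hsm : |∑ i, (w ∘ emb cF m) i| ≤ h := by simpa [Function.comp, sum_comp_emb] using hqm m
    rcases (hpool m.val m.isLt).1 with ⟨x, y, hxy⟩ | hsgn
    · refine lowBiasTree_twoLetter _ h ⟨x, y, fun i => hxy _ (mem_univ _) (hfibval m i)⟩ (fun i => hw _) hsm
        (hR.imp id fun h2 => le_trans (by
          have := Nat.log_mono_right (b := 2) (Nat.log_mono_right (b := 2) (hcard m)); omega) h2)
    · apply lowBiasTree_of_sum_abs_le _ hR1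
      have hs' : (∀ i, 0 ≤ (w ∘ emb cF m) i) ∨ (∀ i, (w ∘ emb cF m) i ≤ 0) :=
        hsgn.imp (fun h0 i => h0 _ (mem_univ _) (hfibval m i)) fun h0 i => h0 _ (mem_univ _) (hfibval m i)
      rw [sum_abs_eq_abs_sum_of_sameSign _ hs']
      exact hsm.trans h6
  -- the quotient word of pool sums: prefix-bounded interval tree
  have hqs : |∑ m, quotWord w cF m| ≤ h := by rw [sum_quotWord]; exact hsum
  have hq : LowBiasTree (quotWord w cF) (Nat.clog 2 (n + 1)) ((6 * h : ℕ) : ℤ) :=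
    (((lowBiasTree_clog_of_bounded (quotWord w cF) h hqm hqs).bias_mono (by push_cast; linarith)).depth_mono
      (Nat.clog_mono_right 2 hM) (hqs.trans h6))
  exact lowBiasTree_graft cF hcF hR1 hfib hq

/-- **Door corollary, logarithmic form.**  No family over alphabets of at most `k + 1` values witnesses
`TreeBiasGrowthAt a`, `a ≥ 2`; the refuted instance is now `c := 9 + ⌈log₂(k+1)⌉`, `C := 6` — a family serving
the instance `(c, 6)` must use more than `2^(c-9)` letter values. [cite: BhargavDuttaSaxena2024, Thm. 1.4] -/
theorem not_boundedLetters_treeBiasGrowthAt_clog {a : ℕ} (ha : 2 ≤ a) (k : ℕ) :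
    ¬ (∀ C : ℕ, ∃ m₀ : ℕ, ∀ m : ℕ, m₀ ≤ m →
        ∀ Δ : ℕ, Δ ≤ a * Nat.log 2 (Nat.log 2 (Nat.log 2 m)) + (9 + Nat.clog 2 (k + 1)) + 1 →
          ∃ (sz : Fin (Nat.sqrt (Nat.log 2 m)) → ℕ) (pos : Fin (Nat.sqrt (Nat.log 2 m)) → Bool),
            (∀ i, 1 ≤ sz i) ∧ (∀ t ≤ Nat.sqrt (Nat.log 2 m), 2 ^ GenWord.overLen sz pos t ≤ m) ∧
            (univ.image (GenWord.wt sz pos)).card ≤ k + 1 ∧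
            TreeBiasGe (GenWord.wt sz pos) Δ
              (2 * (C * (a * Nat.log 2 (Nat.log 2 (Nat.log 2 m)) + (9 + Nat.clog 2 (k + 1)) + 2) *
                Nat.log 2 m))) := by
  intro hG
  obtain ⟨m₀, hm₀⟩ := hG 6
  obtain ⟨m, hmm₀, hm2⟩ : ∃ m, m₀ ≤ m ∧ 2 ≤ m := ⟨max m₀ 2, le_max_left _ _, le_max_right _ _⟩
  have hL : 1 ≤ Nat.log 2 m := Nat.le_log_of_pow_le one_lt_two (by simpa using hm2)
  obtain ⟨sz, pos, _hsz, hfit, hk, hTB⟩ := hm₀ m hmm₀ _ le_rfl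
  have hwi : ∀ i, |GenWord.wt sz pos i| ≤ ((2 * Nat.log 2 m : ℕ) : ℤ) := fun i => abs_wt_le sz pos hfit i
  have hws : |∑ i, GenWord.wt sz pos i| ≤ ((2 * Nat.log 2 m : ℕ) : ℤ) :=
    le_trans (abs_sum_wt_le sz pos hfit) (by push_cast; linarith)
  have hdepth : 2 * Nat.log 2 (Nat.log 2 (2 * Nat.log 2 m)) + 8 + Nat.clog 2 (k + 1) ≤
      a * Nat.log 2 (Nat.log 2 (Nat.log 2 m)) + (9 + Nat.clog 2 (k + 1)) + 1 := by
    have h1 : Nat.log 2 (2 * Nat.log 2 m) = Nat.log 2 (Nat.log 2 m) + 1 := by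
      rw [Nat.mul_comm]; exact Nat.log_mul_base one_lt_two (by omega)
    have h2 : Nat.log 2 (Nat.log 2 (Nat.log 2 m) + 1) ≤ Nat.log 2 (Nat.log 2 (Nat.log 2 m)) + 1 :=
      (le_trans (Nat.log_mono_right (Nat.lt_pow_succ_log_self one_lt_two _)) (Nat.log_pow one_lt_two _).le)
    have h3 : 2 * Nat.log 2 (Nat.log 2 (Nat.log 2 m)) ≤ a * Nat.log 2 (Nat.log 2 (Nat.log 2 m)) :=
      Nat.mul_le_mul_right _ ha
    rw [h1]; omega
  have hT := lowBiasTree_of_card_image_le_clog (2 * Nat.log 2 m) k (GenWord.wt sz pos) hk hwi hws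
    (Or.inl hdepth)
  refine not_treeBiasGe_of_lowBiasTree hT ?_ hTB
  have hnat : (a * Nat.log 2 (Nat.log 2 (Nat.log 2 m)) + (9 + Nat.clog 2 (k + 1)) + 1) *
      (6 * (2 * Nat.log 2 m)) < 2 * (6 * (a * Nat.log 2 (Nat.log 2 (Nat.log 2 m)) +
        (9 + Nat.clog 2 (k + 1)) + 2) * Nat.log 2 m) := by
    have : (a * Nat.log 2 (Nat.log 2 (Nat.log 2 m)) + (9 + Nat.clog 2 (k + 1)) + 1) *
        (6 * (2 * Nat.log 2 m)) + 12 * Nat.log 2 m = 2 * (6 * (a * Nat.log 2 (Nat.log 2 (Nat.log 2 m)) +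
        (9 + Nat.clog 2 (k + 1)) + 2) * Nat.log 2 m) := by
      ring
    omega
  exact_mod_cast hnat

end Summit.ValiantsHypothesis.ValiantsHypothesis.Theorems.DepthWindow.TreeBias
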